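import Mathlib.Analysis.CStarAlgebra.Matrix
import Literature.Computability.Cryptography.QubitRegisterProofs
import HarnessLib

/-!
# Words over the placements of a universal gate set approximate every unitary up to a phase

Topic `Literature/Computability/Cryptography` (trunk CryptoQuantFine, Q1 `QubitRegister`). The
placement-level universality notion of the tree, `QGateSet.IsUniversal G` (for all large `n`,
`GeneratesDenselyModPhase n (placements G n)`: the subgroup of `U(2ⁿ)` generated by the placements of
the gates of `G` on `n` wires *together with all global phases* is dense in `U(2ⁿ)`), is phrased
through `Subgroup.closure` inside the unitary group, i.e. through products of generators AND their
inverses, and modulo the phases. What every compilation argument consumes (the base net of the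
Solovay–Kitaev algorithm, Dawson–Nielsen 2006, §3 "the initial `ε₀`-approximation … can be found by
brute force"; Nielsen–Chuang 2010, §4.5.3–4.5.4; Kitaev–Shen–Vyalyi 2002, §8.1, Def. 8.1 and
Thm. 8.1 "approximate realisation up to a phase factor") is the circuit-level reading:

* **`GeneratesDenselyModPhase.exists_word_mem_of_isOpen`**: if `G` is unitary and inverse-closed and
  its placements on `n` wires generate `U(2ⁿ)` densely modulo phase, then for every unitary `U` and
  every open neighbourhood `O` of `U` there are a *word* `l` over `placements G n` (a list of
  placements, i.e. an honest circuit over `G`, no inverses) and a phase `c`, `‖c‖ = 1`, with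
  `c • l.prod ∈ O`;
* the two metric forms: entrywise (`exists_word_near_entrywise`: `‖(l.prod) i j − c·U i j‖ < ε` for
  all `i, j`) and in the `L²`-operator norm of the Solovay–Kitaev files
  (`exists_word_norm_sub_smul_lt`: `‖l.prod − c • U‖ < ε`), and the `QGateSet.IsUniversal` forms
  (`QGateSet.IsUniversal.exists_word_norm_sub_smul_lt`).

The proof is the closure induction `exists_word_of_mem_closure`: every element of the generated
subgroup is `c • l.prod` for a placement word `l` and a phase `c` — generators are placements or
phases (a phase `c • 1` is unitary only if `‖c‖ = 1`, `norm_eq_one_of_smul_one_mem_unitaryGroup`),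
products concatenate words, and the inverse of a placement word is again a placement word because
`G` is inverse-closed (`QGateSet.IsInverseClosed.exists_inverse_word`: the inverse of each letter is
a word, `QGateSet.IsInverseClosed`, and `(M₁⋯Mₖ)⁻¹ = Mₖ⁻¹⋯M₁⁻¹`) — followed by density: an open
neighbourhood of `U` in `U(2ⁿ)` meets the generated subgroup.

No definition and no named fact is introduced; everything here is proved.

## References

* C. M. Dawson, M. A. Nielsen, *The Solovay–Kitaev algorithm*, Quantum Inf. Comput. 6 (2006)
  81–95, §2 (instruction sets: finite, inverse-closed, generating a dense subgroup), §3 (the base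
  approximation) [DawsonNielsen2006].
* A. Yu. Kitaev, A. H. Shen, M. N. Vyalyi, *Classical and Quantum Computation*, AMS GSM 47 (2002),
  §8.1 (realisation of an operator by a circuit up to a phase factor; approximate realisation)
  [KitaevShenVyalyi2002].
* M. A. Nielsen, I. L. Chuang, *Quantum Computation and Quantum Information*, CUP 2010, §4.5.3
  (a discrete set of universal operations), Box 4.1 (global phase is unobservable)
  [NielsenChuang2010].
-/

noncomputable section

namespace Literature.Computability.Cryptography

open Matrix

variable {G : QGateSet} {n : ℕ}

/-! ### Placement words -/

/-- A product of placements of a unitary gate set is unitary. [cite: NielsenChuang2010, §4.5] -/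
theorem prod_mem_unitaryGroup_of_forall_mem_placements (hU : G.IsUnitary)
    {l : List (Matrix (QReg n) (QReg n) ℂ)} (hl : ∀ M ∈ l, M ∈ placements G n) :
    l.prod ∈ Matrix.unitaryGroup (QReg n) ℂ := by
  induction l with
  | nil => rw [List.prod_nil]; exact Submonoid.one_mem _
  | cons M l ih =>
    rw [List.prod_cons]
    exact Submonoid.mul_mem _
      (QGateSet.placements_subset_unitaryGroup_holds hU n (hl M List.mem_cons_self))
      (ih fun N hN => hl N (List.mem_cons_of_mem M hN))

/-- **The inverse of a placement word is a placement word** (for an inverse-closed gate set): the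
inverse of each letter is a word (`QGateSet.IsInverseClosed`) and `(M₁ ⋯ Mₖ)⁻¹ = Mₖ⁻¹ ⋯ M₁⁻¹`; stated
as a left inverse, `l'.prod * l.prod = 1`. [cite: DawsonNielsen2006, §2] -/
theorem QGateSet.IsInverseClosed.exists_inverse_word (hinv : G.IsInverseClosed) :
    ∀ l : List (Matrix (QReg n) (QReg n) ℂ), (∀ M ∈ l, M ∈ placements G n) →
      ∃ l' : List (Matrix (QReg n) (QReg n) ℂ), (∀ M ∈ l', M ∈ placements G n) ∧
        l'.prod * l.prod = 1
  | [], _ => ⟨[], by simp, by simp⟩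
  | M :: l, hl => by
    obtain ⟨lM, hlM, hM⟩ := hinv n M (hl M List.mem_cons_self)
    obtain ⟨l', hl', h'⟩ :=
      QGateSet.IsInverseClosed.exists_inverse_word hinv l fun N hN => hl N (List.mem_cons_of_mem M hN)
    refine ⟨l' ++ lM, fun N hN => ?_, ?_⟩
    · rcases List.mem_append.1 hN with h | h
      · exact hl' N h
      · exact hlM N h
    · rw [List.prod_append, List.prod_cons, mul_assoc, ← mul_assoc lM.prod, hM, one_mul, h']

/-- A global phase `c • 1` on a (nonempty) register is unitary only if `‖c‖ = 1`. [folklore] -/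
theorem norm_eq_one_of_smul_one_mem_unitaryGroup {c : ℂ}
    (h : c • (1 : Matrix (QReg n) (QReg n) ℂ) ∈ Matrix.unitaryGroup (QReg n) ℂ) : ‖c‖ = 1 := by
  have h1 := Matrix.mem_unitaryGroup_iff.1 h
  rw [star_smul, star_one, smul_mul_smul_comm, one_mul] at h1
  have h2 := congrFun (congrFun h1 (fun _ => false)) (fun _ => false)
  simp only [Matrix.smul_apply, Matrix.one_apply_eq, smul_eq_mul, mul_one] at h2
  -- `h2 : c * star c = 1`
  have h3 : ‖c‖ ^ 2 = 1 := by
    rw [← Complex.normSq_eq_norm_sq, ← Complex.ofReal_inj, Complex.ofReal_one, ← Complex.mul_conj]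
    exact h2
  have h4 : 0 ≤ ‖c‖ := norm_nonneg c
  nlinarith [h3, h4]

/-- **Every element of the subgroup generated by the placements and the phases is a phase times a
placement word** (closure induction; inverses by `exists_inverse_word`).
[cite: KitaevShenVyalyi2002, §8.1 (realisation up to a phase factor)] -/
theorem exists_word_of_mem_closure (hU : G.IsUnitary) (hinv : G.IsInverseClosed)
    {V : Matrix.unitaryGroup (QReg n) ℂ}
    (hV : V ∈ Subgroup.closure {U : Matrix.unitaryGroup (QReg n) ℂ |
      U.1 ∈ placements G n ∨ ∃ c : ℂ, U.1 = c • (1 : Matrix _ _ ℂ)}) :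
    ∃ (l : List (Matrix (QReg n) (QReg n) ℂ)) (c : ℂ), (∀ M ∈ l, M ∈ placements G n) ∧ ‖c‖ = 1 ∧
      (V : Matrix (QReg n) (QReg n) ℂ) = c • l.prod := by
  induction hV using Subgroup.closure_induction with
  | mem x hx =>
    rcases hx with hx | ⟨c, hc⟩
    · exact ⟨[x.1], 1, by simpa using hx, norm_one, by simp⟩
    · refine ⟨[], c, by simp, norm_eq_one_of_smul_one_mem_unitaryGroup (hc ▸ x.2), by simpa using hc⟩
  | one => exact ⟨[], 1, by simp, norm_one, by simp⟩
  | mul x y _ _ ihx ihy =>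
    obtain ⟨l₁, c₁, hl₁, hc₁, e₁⟩ := ihx
    obtain ⟨l₂, c₂, hl₂, hc₂, e₂⟩ := ihy
    refine ⟨l₁ ++ l₂, c₁ * c₂, fun M hM => ?_, by rw [norm_mul, hc₁, hc₂, one_mul], ?_⟩
    · rcases List.mem_append.1 hM with h | h
      · exact hl₁ M h
      · exact hl₂ M h
    · rw [Submonoid.coe_mul, e₁, e₂, List.prod_append, smul_mul_smul_comm]
  | inv x _ ih =>
    obtain ⟨l, c, hl, hc, e⟩ := ih
    obtain ⟨l', hl', h'⟩ := hinv.exists_inverse_word l hl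
    have hlu : l.prod ∈ Matrix.unitaryGroup (QReg n) ℂ :=
      prod_mem_unitaryGroup_of_forall_mem_placements hU hl
    have hstar : star l.prod = l'.prod := by
      have h2 : l.prod * star l.prod = 1 := Matrix.mem_unitaryGroup_iff.1 hlu
      calc star l.prod = (l'.prod * l.prod) * star l.prod := by rw [h', one_mul]
        _ = l'.prod := by rw [mul_assoc, h2, mul_one]
    refine ⟨l', starRingEnd ℂ c, hl', by rwa [RCLike.norm_conj], ?_⟩
    rw [← Unitary.star_eq_inv, Unitary.coe_star, e, star_smul, hstar]
    rfl

/-! ### Density: placement words enter every neighbourhood, up to a phase -/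

/-- **Placement words approximate every unitary up to a phase** (topological form): if the
placements of a unitary, inverse-closed gate set on `n` wires generate `U(2ⁿ)` densely modulo phase,
then every open neighbourhood of a unitary `U` contains `c • l.prod` for some placement word `l` and
some phase `c` with `‖c‖ = 1`. [cite: KitaevShenVyalyi2002, §8.1 (Def. 8.1, approximate realisation up to a phase)]
[cite: DawsonNielsen2006, §2–3] -/
theorem GeneratesDenselyModPhase.exists_word_mem_of_isOpen (hU : G.IsUnitary)
    (hinv : G.IsInverseClosed) (h : GeneratesDenselyModPhase n (placements G n))
    {U : Matrix (QReg n) (QReg n) ℂ} (hUu : U ∈ Matrix.unitaryGroup (QReg n) ℂ)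
    {O : Set (Matrix (QReg n) (QReg n) ℂ)} (hO : IsOpen O) (hUO : U ∈ O) :
    ∃ (l : List (Matrix (QReg n) (QReg n) ℂ)) (c : ℂ), (∀ M ∈ l, M ∈ placements G n) ∧ ‖c‖ = 1 ∧
      c • l.prod ∈ O := by
  have hmem := h (⟨U, hUu⟩ : Matrix.unitaryGroup (QReg n) ℂ)
  rw [mem_closure_iff] at hmem
  obtain ⟨V, hVO, hVH⟩ := hmem (Subtype.val ⁻¹' O) (hO.preimage continuous_subtype_val) hUO
  obtain ⟨l, c, hl, hc, e⟩ := exists_word_of_mem_closure hU hinv hVH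
  exact ⟨l, c, hl, hc, e ▸ hVO⟩

/-- **Entrywise form**: a placement word whose product is entrywise within `ε` of `c • U` for a
phase `c`. [cite: NielsenChuang2010, §4.5.3] -/
theorem GeneratesDenselyModPhase.exists_word_near_entrywise (hU : G.IsUnitary)
    (hinv : G.IsInverseClosed) (h : GeneratesDenselyModPhase n (placements G n))
    {U : Matrix (QReg n) (QReg n) ℂ} (hUu : U ∈ Matrix.unitaryGroup (QReg n) ℂ) {ε : ℝ}
    (hε : 0 < ε) :
    ∃ (l : List (Matrix (QReg n) (QReg n) ℂ)) (c : ℂ), (∀ M ∈ l, M ∈ placements G n) ∧ ‖c‖ = 1 ∧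
      ∀ i j, ‖l.prod i j - c * U i j‖ < ε := by
  -- the open box around `U`
  let O : Set (Matrix (QReg n) (QReg n) ℂ) := {V | ∀ i j, ‖V i j - U i j‖ < ε}
  have hO : IsOpen O := by
    have hO' : O = ⋂ i, ⋂ j, (fun V : Matrix (QReg n) (QReg n) ℂ => V i j) ⁻¹' Metric.ball (U i j) ε := by
      ext V
      simp [O, Metric.mem_ball, dist_eq_norm]
    rw [hO']
    exact isOpen_iInter_of_finite fun i => isOpen_iInter_of_finite fun j =>
      Metric.isOpen_ball.preimage (continuous_id.matrix_elem i j)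
  have hUO : U ∈ O := fun i j => by simpa using hε
  obtain ⟨l, c, hl, hc, hlO⟩ := h.exists_word_mem_of_isOpen hU hinv hUu hO hUO
  have hcc : starRingEnd ℂ c * c = 1 := by
    rw [← Complex.normSq_eq_conj_mul_self, Complex.normSq_eq_norm_sq, hc]
    simp
  refine ⟨l, starRingEnd ℂ c, hl, by rwa [RCLike.norm_conj], fun i j => ?_⟩
  have hij := hlO i j
  rw [Matrix.smul_apply, smul_eq_mul] at hij
  calc ‖l.prod i j - starRingEnd ℂ c * U i j‖
      = ‖starRingEnd ℂ c * (c * l.prod i j - U i j)‖ := by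
        rw [mul_sub, ← mul_assoc, hcc, one_mul]
    _ = ‖c * l.prod i j - U i j‖ := by rw [norm_mul, RCLike.norm_conj, hc, one_mul]
    _ < ε := hij

section L2Operator

open scoped Matrix.Norms.L2Operator

/-- **Operator-norm form** (the `L²`-operator norm on `Matrix (QReg n) (QReg n) ℂ` of the
Solovay–Kitaev files, `Matrix.instL2OpNormedAddCommGroup`): a placement word `l` and a phase `c` with
`‖l.prod − c • U‖ < ε`. [cite: DawsonNielsen2006, §2–3] [cite: KitaevShenVyalyi2002, §8.1] -/
theorem GeneratesDenselyModPhase.exists_word_norm_sub_smul_lt (hU : G.IsUnitary)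
    (hinv : G.IsInverseClosed) (h : GeneratesDenselyModPhase n (placements G n))
    {U : Matrix (QReg n) (QReg n) ℂ} (hUu : U ∈ Matrix.unitaryGroup (QReg n) ℂ) {ε : ℝ}
    (hε : 0 < ε) :
    ∃ (l : List (Matrix (QReg n) (QReg n) ℂ)) (c : ℂ), (∀ M ∈ l, M ∈ placements G n) ∧ ‖c‖ = 1 ∧
      ‖l.prod - c • U‖ < ε := by
  obtain ⟨l, c, hl, hc, hlO⟩ :=
    h.exists_word_mem_of_isOpen hU hinv hUu Metric.isOpen_ball (Metric.mem_ball_self hε)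
  have hcc : starRingEnd ℂ c * c = 1 := by
    rw [← Complex.normSq_eq_conj_mul_self, Complex.normSq_eq_norm_sq, hc]
    simp
  refine ⟨l, starRingEnd ℂ c, hl, by rwa [RCLike.norm_conj], ?_⟩
  rw [Metric.mem_ball, dist_eq_norm] at hlO
  calc ‖l.prod - starRingEnd ℂ c • U‖ = ‖starRingEnd ℂ c • (c • l.prod - U)‖ := by
        rw [smul_sub, smul_smul, hcc, one_smul]
    _ = ‖c • l.prod - U‖ := by rw [norm_smul, RCLike.norm_conj, hc, one_mul]
    _ < ε := hlO

/-- **Universality, circuit-level reading**: for a unitary, inverse-closed, universal gate set there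
is a threshold `n₀` such that on every register of `n ≥ n₀` wires every unitary is approximated in
operator norm, to any accuracy and up to a global phase, by the product of a placement word (an
honest circuit over `G`). [cite: NielsenChuang2010, §4.5.3] [cite: DawsonNielsen2006, §2–3] -/
theorem QGateSet.IsUniversal.exists_word_norm_sub_smul_lt (hU : G.IsUnitary)
    (hinv : G.IsInverseClosed) (huniv : G.IsUniversal) :
    ∃ n₀ : ℕ, ∀ n ≥ n₀, ∀ U ∈ Matrix.unitaryGroup (QReg n) ℂ, ∀ ε : ℝ, 0 < ε →
      ∃ (l : List (Matrix (QReg n) (QReg n) ℂ)) (c : ℂ), (∀ M ∈ l, M ∈ placements G n) ∧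
        ‖c‖ = 1 ∧ ‖l.prod - c • U‖ < ε := by
  obtain ⟨n₀, hn₀⟩ := huniv
  exact ⟨n₀, fun n hn U hUu ε hε =>
    (hn₀ n hn).exists_word_norm_sub_smul_lt hU hinv hUu hε⟩

end L2Operator

end Literature.Computability.Cryptography
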